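import Summits.QuantumFields.YangMills.Theorems.ScalingWindowSplitCurvatureAmnesiaWilsonSchwingerDyson
import Literature.MathematicalPhysics.QuantumFieldTheory.YangMillsOS
import HarnessLib

/-!
# The one-link Schwinger–Dyson identity for a string of smeared curvature fields (crux stmt-QuantumFields-16192, line `WardDefectSketch`)

Support file for the crux item stmt-QuantumFields-16192 (`CoincidenceRotationBootstrap.CurvatureAmnesia`),
line `WardDefectSketch`, step (W-exact b3) of the lattice rotation-Ward engine: the registered sub-goal
`wilson_schwingerDyson_curvatureString`.

The Schwinger–Dyson (integration-by-parts) identity of Wilson's torus measure along the one-link left shift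
`U ↦ U[e ↦ k(t) U_e]` (`SchwingerDyson.integral_shiftDeriv_eq_wilson`, `∫ f' dμ_β = β ∫ f S' dμ_β`) is stated
for ONE continuous observable `f` with a continuous shift-derivative `f'`.  The observables of the line are
STRINGS `X(U) = ∏ⱼ Φⱼ(U)` of smeared curvature fields
`Φⱼ(U) = c_j a⁴ Σ_{y ∈ Λ} f_j(a y) (actionDensity ρ (τ_y Ũ) − m_j)`, `Ũ = torusLift S U` the periodic lift and
`τ_y = configShift (-y)` the lattice translation.  This file packages the identity for the whole string, with
the Leibniz rule over the slots: given per-slot shift-derivatives `Φ'ⱼ` (hypotheses; computed explicitly in the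
sibling file `…ActionDensityOneLinkDeriv`) and a shift-derivative `S'` of the Wilson action,
`∫ Σⱼ Φ'ⱼ ∏_{l ≠ j} Φ_l dμ_β = β ∫ (∏ⱼ Φⱼ) S' dμ_β`.

* `StringSD.continuous_smearedLatticeField_torusLift`: `U ↦ Φ(f)(torusLift S U)` is continuous on the torus
  configuration space for a continuous observable (composition of `continuous_configShift`, the continuity of
  the periodic lift and finite sums);
* `StringSD.hasDerivAt_prod_path`: the Leibniz rule at `t = 0` for a product of functions of a path `γ` with
  `γ 0 = U` (Mathlib `HasDerivAt.fun_finsetProd`, rearranged to `Σⱼ Φ'ⱼ · ∏_{l ≠ j} Φ_l(U)`);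
* `wilson_schwingerDyson_curvatureString` (registered signature, verbatim).

Everything is elementary; no definitions, no notation.  References: folklore (product rule); M. Creutz,
*Quarks, gluons and lattices* (1983), Ch. 11 for the Schwinger–Dyson equations of lattice gauge theory.
-/

noncomputable section

namespace Summit.QuantumFields.YangMills.Cruxes.CurvatureAmnesia.WardDefect

open scoped BigOperators Topology
open Filter MeasureTheory
open Literature.MathematicalPhysics.QuantumLattice Literature.MathematicalPhysics.AQFT
  Literature.MathematicalPhysics.QuantumFieldTheory

namespace StringSD

/-! ### Continuity of the smeared fields on the torus configuration space -/

section Continuity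

variable {G : Type} [TopologicalSpace G] [MeasurableSpace G]

/-- The translate `τ_x Ũ = configShift (-x) (torusLift S U)` of the periodic lift depends continuously on the
torus configuration `U` (both maps are precompositions). [folklore] -/
theorem continuous_configShift_torusLift (S : ℕ) (x : Fin 4 → ℤ) :
    Continuous fun U : GaugeConfig 4 S G => configShift (-x) (torusLift S U) :=
  (continuous_configShift (-x)).comp (continuous_pi fun _ => continuous_apply _)

/-- The smeared field `Φ(f)(Ũ) = c a⁴ Σ_{x ∈ Λ} f(a x) (O(τ_x Ũ) − m)` of a continuous observable `O`, as a
function of the torus configuration `U` (`Ũ = torusLift S U`), is continuous. [folklore] -/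
theorem continuous_smearedLatticeField_torusLift {O : LGConfig 4 G → ℝ} (hO : Continuous O)
    (Λ : Finset (Fin 4 → ℤ)) (a c m : ℝ) (f : SchwartzMap (EuclideanSpace ℝ (Fin 4)) ℝ) (S : ℕ) :
    Continuous fun U : GaugeConfig 4 S G => smearedLatticeField O Λ a c m f (torusLift S U) := by
  unfold smearedLatticeField
  refine continuous_const.mul (continuous_finsetSum _ fun x _ => continuous_const.mul ?_)
  exact (hO.comp (continuous_configShift_torusLift S x)).sub continuous_const

end Continuity

/-! ### The Leibniz rule along a path -/

/-- **Leibniz rule at `t = 0` along a path.**  If each `t ↦ Φⱼ(γ t)` has derivative `Φ'ⱼ` at `0` and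
`γ 0 = U`, then `t ↦ ∏ⱼ Φⱼ(γ t)` has derivative `Σⱼ Φ'ⱼ ∏_{l ≠ j} Φ_l(U)` at `0`
(Mathlib `HasDerivAt.fun_finsetProd`, with the undifferentiated factors evaluated at `γ 0 = U`). [folklore] -/
theorem hasDerivAt_prod_path {α : Type*} {n : ℕ} (Φ : Fin n → α → ℝ) (Φ' : Fin n → ℝ) (γ : ℝ → α)
    {U : α} (h0 : γ 0 = U) (h : ∀ j, HasDerivAt (fun t => Φ j (γ t)) (Φ' j) 0) :
    HasDerivAt (fun t => ∏ j, Φ j (γ t)) (∑ j, Φ' j * ∏ l ∈ Finset.univ.erase j, Φ l U) 0 := by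
  have hprod := HasDerivAt.fun_finsetProd (u := Finset.univ) (f := fun j t => Φ j (γ t)) (f' := Φ')
    (x := (0 : ℝ)) fun j _ => h j
  refine hprod.congr_deriv (Finset.sum_congr rfl fun j _ => ?_)
  rw [smul_eq_mul, mul_comm, h0]

end StringSD

/-- **One-link Schwinger–Dyson identity for a string of smeared curvature fields** (registered sub-goal of crux
item stmt-QuantumFields-16192, step (W-exact b3)).  For a compact group `G` with a lattice representation `r`,
the torus `(ℤ/S)⁴`, a coupling `β`, an edge `e` and a multiplicative family `k` with `r.ρ(k(t)) = exp(tX)`: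
if the smeared curvature fields `Φⱼ(U) = c_j a⁴ Σ_{y ∈ Λ} f_j(a y)(actionDensity r.ρ (τ_y Ũ) − m_j)` have
continuous shift-derivatives `Φ'ⱼ` along `U ↦ U[e ↦ k(t)U_e]` at `t = 0` and `S'` is a continuous
shift-derivative of the Wilson action, then
`∫ Σⱼ Φ'ⱼ ∏_{l ≠ j} Φ_l dμ_β = β ∫ (∏ⱼ Φⱼ) S' dμ_β` (`μ_β = wilsonMeasure r.ρ β`):
`SchwingerDyson.integral_shiftDeriv_eq_wilson` for `f = ∏ⱼ Φⱼ`, whose shift-derivative is the Leibniz sum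
(`StringSD.hasDerivAt_prod_path`, `SchwingerDyson.shift_zero`), continuity from
`StringSD.continuous_smearedLatticeField_torusLift` and `continuous_actionDensity`. [folklore] -/
theorem wilson_schwingerDyson_curvatureString : ∀ (G : Type) [Group G] [TopologicalSpace G] [IsTopologicalGroup G] [CompactSpace G] [MeasurableSpace G] [BorelSpace G] (r : LatticeRep G) (S : ℕ) [NeZero S] (β : ℝ) (e : Edge 4 S) (k : ℝ → G), (∀ s t : ℝ, k (s + t) = k s * k t) → ∀ (X : Matrix (Fin r.N) (Fin r.N) ℂ), (∀ t : ℝ, r.ρ (k t) = NormedSpace.exp ((t : ℂ) • X)) → ∀ (Λ : Finset (Fin 4 → ℤ)) (a : ℝ) (n : ℕ) (c m : Fin n → ℝ) (f : Fin n → SchwartzMap (EuclideanSpace ℝ (Fin 4)) ℝ) (Φ' : Fin n → GaugeConfig 4 S G → ℝ), (∀ j, Continuous (Φ' j)) → (∀ (j : Fin n) (U : GaugeConfig 4 S G), HasDerivAt (fun t : ℝ => smearedLatticeField (actionDensity r.ρ) Λ a (c j) (m j) (f j) (torusLift S (Function.update U e (k t * U e)))) (Φ' j U) 0) → ∀ (S'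 : GaugeConfig 4 S G → ℝ), Continuous S' → (∀ U : GaugeConfig 4 S G, HasDerivAt (fun t : ℝ => wilsonAction (d := 4) (L := S) r.ρ (Function.update U e (k t * U e))) (S' U) 0) → ∫ U, (∑ j : Fin n, Φ' j U * ∏ l ∈ Finset.univ.erase j, smearedLatticeField (actionDensity r.ρ) Λ a (c l) (m l) (f l) (torusLift S U)) ∂(wilsonMeasure (d := 4) (L := S) r.ρ β) = β * ∫ U, (∏ j : Fin n, smearedLatticeField (actionDensity r.ρ) Λ a (c j) (m j) (f j) (torusLift S U)) * S' U ∂(wilsonMeasure (d := 4) (L := S) r.ρ β) := by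
  intro G _ _ _ _ _ _ r S _ β e k hk X _hX Λ a n c m f Φ' hΦ'c hΦ' S' hS'c hS'
  -- the slots `Φ j U = Φ(f_j)(torusLift S U)` as functions of the torus configuration
  let Φ : Fin n → GaugeConfig 4 S G → ℝ := fun j U =>
    smearedLatticeField (actionDensity r.ρ) Λ a (c j) (m j) (f j) (torusLift S U)
  have hΦc : ∀ j, Continuous (Φ j) := fun j =>
    StringSD.continuous_smearedLatticeField_torusLift (continuous_actionDensity r.continuous) Λ a (c j) (m j)
      (f j) S
  -- continuity of the string and of its Leibniz sum
  have hfc : Continuous fun U : GaugeConfig 4 S G => ∏ j, Φ j U :=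
    continuous_finsetProd _ fun j _ => hΦc j
  have hf'c : Continuous fun U : GaugeConfig 4 S G => ∑ j, Φ' j U * ∏ l ∈ Finset.univ.erase j, Φ l U :=
    continuous_finsetSum _ fun j _ => (hΦ'c j).mul (continuous_finsetProd _ fun l _ => hΦc l)
  -- the Leibniz rule along the one-link shift, factors evaluated at `U[e ↦ k(0)U_e] = U`
  have hf' : ∀ U : GaugeConfig 4 S G,
      HasDerivAt (fun t : ℝ => ∏ j, Φ j (Function.update U e (k t * U e)))
        (∑ j, Φ' j U * ∏ l ∈ Finset.univ.erase j, Φ l U) 0 := fun U =>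
    StringSD.hasDerivAt_prod_path Φ (fun j => Φ' j U) (fun t : ℝ => Function.update U e (k t * U e))
      (SchwingerDyson.shift_zero hk e U) fun j => hΦ' j U
  exact SchwingerDyson.integral_shiftDeriv_eq_wilson r β e hk (fun U => ∏ j, Φ j U)
    (fun U => ∑ j, Φ' j U * ∏ l ∈ Finset.univ.erase j, Φ l U) hfc hf'c hf' S' hS'c hS'

end Summit.QuantumFields.YangMills.Cruxes.CurvatureAmnesia.WardDefect

end
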